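import Summits.ValiantsHypothesis.ValiantsHypothesis.Theorems.SymPencilPerFourInnerRankNineHyperplane
import Summits.ValiantsHypothesis.ValiantsHypothesis.Theorems.SymPencilPerFourInnerRankFamily

/-!
# Route `SymPencil` — inner rank on hyperplanes, II: the family step with the base point and the
# derivative direction confined to a subspace `U'` (IR9U programme; `--supports`
# stmt-ValiantsHypothesis-5674 `SdcSuperquadratic`; rung currency only — nothing here bears on
# `VP ≠ VNP`)

`SymPencilPerFourInnerRankFamily.family_step` (val-width-5674-p2 g2) is the heart of the
full-space inner-rank bound: at `u = (a, β e₂ + γ e₃)` with `a₀ a₁ β γ (a₂ γ + a₃ β) ≠ 0` a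
kernel vector of the eight forms `t_r(u, ·)` exists, is `(α k, α' k)` (`k = β e₂ - γ e₃`), and
differentiating the identity along `u ↦ u + (0, e₀)` gives `α α' = 0`.  In the `u`-RESTRICTED
setting IR9U (`SymPencilPerFourInnerRankNineHyperplane`) the identity is only available for
`u ∈ U'`; this file re-proves the step USING ONLY points of `U'`:

* `polar_at`: polarisation in `y` at one base point;
* `permanent_rows_kk`: `per [x; y; k; k] = -2βγ (x₀ y₁ + x₁ y₀)` — the derivative value in an
  ARBITRARY direction;
* `family_step_U`: the family step for `u ∈ U'`, with the direction `(0, e₀)` replaced by any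
  `δ ∈ U'` with `a₀ δ.2 1 + a₁ δ.2 0 ≠ 0` (all weights `c_r ≠ 0` assumed — restrict to the support
  of `c` first, as in `SymPencilPerFourInnerRankTen`).

Honest framing: a lemma of the IR9U programme (blueprint: `HOME(val-lit)/NOTE-port4g2-CELL-NINE-SEVEN.md`
§6); IR9U/IR9H and the cell `(9,7,8)` stay OPEN/conditional; window `27 ≤ sdc(per₄) ≤ 29`
UNCHANGED; `VP ≠ VNP` not moved; no summit statement is proved here.  No definitions, no named
facts. [folklore]
-/

noncomputable section

-- single-conjunct layout: Sub = Summit, duplicated namespace component intended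
set_option linter.dupNamespace false

namespace Summit.ValiantsHypothesis.ValiantsHypothesis.Theorems.SymPencilPerFourInnerRankNineHyperplaneFamily

open Matrix Finset Module
open Summit.ValiantsHypothesis.ValiantsHypothesis.Theorems.SymPencilPerFourInnerRankRows
open Summit.ValiantsHypothesis.ValiantsHypothesis.Theorems.SymPencilPerFourInnerRankFamily
open Summit.ValiantsHypothesis.ValiantsHypothesis.Theorems.SymPencilPerFourOneRowPoint

variable {K : Type*} [Field K]

/-- **Polarisation in `y` at one base point `u`.** [folklore] -/
theorem polar_at (c : Fin 8 → K)
    (t : Fin 8 → (((Fin 4 → K) × (Fin 4 → K)) →ₗ[K] ((Fin 4 → K) × (Fin 4 → K)) →ₗ[K] K))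
    (u : (Fin 4 → K) × (Fin 4 → K))
    (hJu : ∀ y₂ y₃ : Fin 4 → K,
      ∑ r, c r * (t r u (y₂, y₃)) ^ 2 = (Matrix.of ![u.1, u.2, y₂, y₃]).permanent)
    (y₂ y₃ y₂' y₃' : Fin 4 → K) :
    2 * ∑ r, c r * t r u (y₂, y₃) * t r u (y₂', y₃') =
      (Matrix.of ![u.1, u.2, y₂, y₃']).permanent + (Matrix.of ![u.1, u.2, y₂', y₃]).permanent := by
  have h1 := hJu (y₂ + y₂') (y₃ + y₃')
  have h2 := hJu y₂ y₃
  have h3 := hJu y₂' y₃'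
  have hsplit : ∀ r, t r u (y₂ + y₂', y₃ + y₃') = t r u (y₂, y₃) + t r u (y₂', y₃') :=
    fun r => by rw [← map_add]; rfl
  simp_rw [hsplit] at h1
  rw [per_add_row₂, per_add_row₃, per_add_row₃] at h1
  have hsq : ∑ r, c r * (t r u (y₂, y₃) + t r u (y₂', y₃')) ^ 2 =
      ∑ r, c r * (t r u (y₂, y₃)) ^ 2 +
        2 * ∑ r, c r * t r u (y₂, y₃) * t r u (y₂', y₃') +
        ∑ r, c r * (t r u (y₂', y₃')) ^ 2 := by
    rw [Finset.mul_sum, ← Finset.sum_add_distrib, ← Finset.sum_add_distrib]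
    exact Finset.sum_congr rfl fun r _ => by ring
  linear_combination h1 - h2 - h3 - hsq

/-- **The derivative value in an arbitrary direction**: `per [x; y; k; k] = -2βγ (x₀ y₁ + x₁ y₀)`
for `k = β e₂ - γ e₃`. [folklore] -/
theorem permanent_rows_kk (x y : Fin 4 → K) (β γ : K) :
    (Matrix.of ![x, y, β • Pi.single (2 : Fin 4) (1 : K) - γ • Pi.single 3 1,
      β • Pi.single (2 : Fin 4) (1 : K) - γ • Pi.single 3 1]).permanent =
      -(2 * β * γ) * (x 0 * y 1 + x 1 * y 0) := by
  rw [permanent_of_rows]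
  simp
  ring

/-- **The family step inside a subspace `U'`.**  If the joint identity holds for all `u ∈ U'`, all
weights are non-zero, `u = (a, β e₂ + γ e₃) ∈ U'` with `a₀ a₁ β γ (a₂ γ + a₃ β) ≠ 0`, and some
`δ ∈ U'` has `a₀ δ.2 1 + a₁ δ.2 0 ≠ 0`, then with `k = β e₂ - γ e₃` either `t_r(u, (k, 0)) = 0`
for all `r` or `t_r(u, (0, k)) = 0` for all `r`. [folklore] -/
theorem family_step_U [CharZero K] (U' : Submodule K ((Fin 4 → K) × (Fin 4 → K)))
    (c : Fin 8 → K) (hc : ∀ r, c r ≠ 0)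
    (t : Fin 8 → (((Fin 4 → K) × (Fin 4 → K)) →ₗ[K] ((Fin 4 → K) × (Fin 4 → K)) →ₗ[K] K))
    (hJ : ∀ u ∈ U', ∀ y₂ y₃ : Fin 4 → K,
      ∑ r, c r * (t r u (y₂, y₃)) ^ 2 = (Matrix.of ![u.1, u.2, y₂, y₃]).permanent)
    (a : Fin 4 → K) (β γ : K)
    (hu : ((a, β • Pi.single (2 : Fin 4) (1 : K) + γ • Pi.single 3 1) :
      (Fin 4 → K) × (Fin 4 → K)) ∈ U')
    (hgood : a 0 * a 1 * β * γ * (a 2 * γ + a 3 * β) ≠ 0)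
    (δ : (Fin 4 → K) × (Fin 4 → K)) (hδ : δ ∈ U') (hδgood : a 0 * δ.2 1 + a 1 * δ.2 0 ≠ 0) :
    (∀ r, t r (a, β • Pi.single (2 : Fin 4) (1 : K) + γ • Pi.single 3 1)
        (β • Pi.single (2 : Fin 4) (1 : K) - γ • Pi.single 3 1, 0) = 0) ∨
    (∀ r, t r (a, β • Pi.single (2 : Fin 4) (1 : K) + γ • Pi.single 3 1)
        (0, β • Pi.single (2 : Fin 4) (1 : K) - γ • Pi.single 3 1) = 0) := by
  set b : Fin 4 → K := β • Pi.single (2 : Fin 4) (1 : K) + γ • Pi.single 3 1 with hb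
  set k : Fin 4 → K := β • Pi.single (2 : Fin 4) (1 : K) - γ • Pi.single 3 1 with hk
  have hgood' := hgood
  simp only [ne_eq, mul_eq_zero, not_or] at hgood'
  obtain ⟨⟨⟨⟨ha0, ha1⟩, hβ⟩, hγ⟩, hm⟩ := hgood'
  have hJu : ∀ y₂ y₃ : Fin 4 → K,
      ∑ r, c r * (t r (a, b) (y₂, y₃)) ^ 2 = (Matrix.of ![a, b, y₂, y₃]).permanent :=
    fun y₂ y₃ => hJ (a, b) hu y₂ y₃
  -- `(k, 0)` is in the radical of the pairing at `u`
  have hrad : ∀ y₂' y₃' : Fin 4 → K, ∑ r, c r * t r (a, b) (k, 0) * t r (a, b) (y₂', y₃') = 0 := by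
    intro y₂' y₃'
    have h := polar_at c t (a, b) hJu k 0 y₂' y₃'
    simp only at h
    rw [hb, hk, per_family_kernel, ← hb, per_zero_row₃, add_zero] at h
    exact (mul_eq_zero.1 h).resolve_left two_ne_zero
  -- hence the forms `t_r(u, ·)` have a common non-trivial zero `w`
  let Tu : ((Fin 4 → K) × (Fin 4 → K)) →ₗ[K] (Fin 8 → K) := LinearMap.pi fun r => t r (a, b)
  have hTu : ∀ y r, Tu y r = t r (a, b) y := fun y r => rfl
  have hker : LinearMap.ker Tu ≠ ⊥ := by
    intro hbot
    have hinj : Function.Injective Tu := LinearMap.ker_eq_bot.1 hbot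
    have hsurj : Function.Surjective Tu :=
      (LinearMap.injective_iff_surjective_of_finrank_eq_finrank (by
        rw [finrank_prod, finrank_fintype_fun_eq_card, finrank_fintype_fun_eq_card,
          Fintype.card_fin, Fintype.card_fin])).1 hinj
    have hk0 : Tu (k, 0) = 0 := by
      funext r
      obtain ⟨y', hy'⟩ := hsurj (Pi.single r 1)
      have h := hrad y'.1 y'.2
      have hy'' : ∀ r', t r' (a, b) (y'.1, y'.2) = (Pi.single r (1 : K) : Fin 8 → K) r' :=
        fun r' => by rw [Prod.mk.eta, ← hTu, hy']
      simp_rw [hy'', Pi.single_apply, mul_ite, mul_one, mul_zero, Finset.sum_ite_eq',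
        Finset.mem_univ, if_true] at h
      rw [hTu, Pi.zero_apply]
      exact (mul_eq_zero.1 h).resolve_left (hc r)
    have h0 : ((k, 0) : (Fin 4 → K) × (Fin 4 → K)) = 0 := hinj (by rw [hk0, map_zero])
    have : k 2 = 0 := by rw [(Prod.mk_eq_zero.1 h0).1]; rfl
    simp [hk] at this
    exact hβ this
  obtain ⟨w, hw, hw0⟩ := Submodule.exists_mem_ne_zero_of_ne_bot hker
  have hTw : ∀ r, t r (a, b) (w.1, w.2) = 0 := fun r => by
    rw [Prod.mk.eta, ← hTu]; exact congr_fun (LinearMap.mem_ker.1 hw) r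
  -- both halves of `w` are kernel vectors of the pairing, hence multiples of `k`
  have hw1 : ∀ v, (Matrix.of ![a, b, v, w.1]).permanent = 0 := by
    intro v
    have h := polar_at c t (a, b) hJu w.1 w.2 0 v
    simp only at h
    rw [per_zero_row₂, add_zero, show ∑ r, c r * t r (a, b) (w.1, w.2) * t r (a, b) (0, v) = 0
      from Finset.sum_eq_zero fun r _ => by rw [hTw, mul_zero, zero_mul], mul_zero] at h
    rw [← per_swap_row₂₃]; exact h.symm
  have hw2 : ∀ v, (Matrix.of ![a, b, v, w.2]).permanent = 0 := by
    intro v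
    have h := polar_at c t (a, b) hJu w.1 w.2 v 0
    simp only at h
    rw [per_zero_row₃, zero_add, show ∑ r, c r * t r (a, b) (w.1, w.2) * t r (a, b) (v, 0) = 0
      from Finset.sum_eq_zero fun r _ => by rw [hTw, mul_zero, zero_mul], mul_zero] at h
    exact h.symm
  have e1 := kernel_family a w.1 β γ hgood hw1
  have e2 := kernel_family a w.2 β γ hgood hw2
  rw [← hk] at e1 e2
  set α := w.1 2 / β with hα
  set α' := w.2 2 / β with hα'
  -- differentiate the identity at `u` in the direction `δ ∈ U'`
  have hd1 := hJ ((a, b) + δ) (U'.add_mem hu hδ) w.1 w.2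
  have hd2 := hJ δ hδ w.1 w.2
  have hd0 := hJ (a, b) hu w.1 w.2
  have hsplit : ∀ r, t r ((a, b) + δ) (w.1, w.2) = t r δ (w.1, w.2) := fun r => by
    rw [map_add, LinearMap.add_apply, hTw r, zero_add]
  simp_rw [hsplit] at hd1
  simp only [Prod.fst_add, Prod.snd_add] at hd1
  rw [per_add_row₀] at hd1
  rw [per_add_row₁ a b δ.2 w.1 w.2, per_add_row₁ δ.1 b δ.2 w.1 w.2] at hd1
  simp only at hd0
  simp_rw [hTw] at hd0
  simp only [ne_eq, OfNat.ofNat_ne_zero, not_false_eq_true, zero_pow, mul_zero,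
    Finset.sum_const_zero] at hd0
  have hder : (Matrix.of ![a, δ.2, w.1, w.2]).permanent +
      (Matrix.of ![δ.1, b, w.1, w.2]).permanent = 0 := by
    linear_combination hd2 + hd0 - hd1
  rw [e1, e2, per_smul_row₂, per_smul_row₃, per_smul_row₂, per_smul_row₃, hk, permanent_rows_kk,
    permanent_rows_kk] at hder
  have hb0 : b 0 = 0 := by simp [hb]
  have hb1 : b 1 = 0 := by simp [hb]
  rw [hb0, hb1] at hder
  have hαα : α * α' = 0 := by
    have : α * α' * (-(2 * β * γ) * (a 0 * δ.2 1 + a 1 * δ.2 0)) = 0 := by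
      linear_combination hder
    refine (mul_eq_zero.1 this).resolve_right ?_
    exact mul_ne_zero (neg_ne_zero.2 (mul_ne_zero (mul_ne_zero two_ne_zero hβ) hγ)) hδgood
  rcases mul_eq_zero.1 hαα with h0 | h0
  · -- `w.1 = 0`, so `w = (0, α' k)` with `α' ≠ 0`
    right
    have hw1z : w.1 = 0 := by rw [e1, h0, zero_smul]
    have hα'0 : α' ≠ 0 := by
      intro h'
      apply hw0
      exact Prod.ext hw1z (by rw [e2, h', zero_smul]; rfl)
    intro r
    have h := hTw r
    rw [hw1z, e2, show ((0 : Fin 4 → K), α' • k) = α' • ((0 : Fin 4 → K), k) by simp, map_smul,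
      smul_eq_mul] at h
    exact (mul_eq_zero.1 h).resolve_left hα'0
  · left
    have hw2z : w.2 = 0 := by rw [e2, h0, zero_smul]
    have hα0 : α ≠ 0 := by
      intro h'
      apply hw0
      exact Prod.ext (by rw [e1, h', zero_smul]; rfl) hw2z
    intro r
    have h := hTw r
    rw [hw2z, e1, show ((α • k, (0 : Fin 4 → K)) : (Fin 4 → K) × (Fin 4 → K)) =
      α • (k, (0 : Fin 4 → K)) by simp, map_smul, smul_eq_mul] at h
    exact (mul_eq_zero.1 h).resolve_left hα0

end Summit.ValiantsHypothesis.ValiantsHypothesis.Theorems.SymPencilPerFourInnerRankNineHyperplaneFamily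

end
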